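import Summits.CriticalPhenomena.PercolationContinuityZ3.Theorems.PercNearOneGluingNoHeavyLowerTailSahiCombMixRungs

/-!
# The HALF letter on the fully mixed background: `HalfMix ⟹ HALF(½) ⟹` Kahn's Conjecture 5

Support file of the one-cut programme (crux `NoHeavyLowerTail`, stmt-CriticalPhenomena-4575; cell `prim-bnk`, seat bnk-2 gen 12,
memo `run/shared/lean/prim/prim-l12/FROM-prim-bnk-2-g12-MIX-RUNGS.md`; INEQ-CLAIMS row HALF-MIX).  Companion of `…SahiCombMixRungs`
(`MixFree`, `mfSum`, `disSum`, `Dis`, the peeling identity `mfSum_insert`).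

With `c_U(j)` the three-copy comb array (`SahiComb.combCoeff 3 (1_U) j`) and `disSum U R` the full-disagreement sum of the companion:
* `halfLetter` — the HALF letter `ε = (−1, 1, 1, −1)` on a digit (`+1` on the mixed digits, `−1` on the section digits); `hmSum U a R S`
  — the lettered mixed/free sum `Σ ε(j_a)·c_U(j)` (mixed on `R`, free on `S ∪ {a}`, `0` elsewhere).
* **`HalfMix` (conjecture HALF-MIX, new, OPEN)**: `disSum U^{a←0} R + disSum U^{a←1} R ≤ disSum U (insert a R)` for every triple of
  increasing events determined by `insert a R` — the full-disagreement sum is super-additive under sectioning; equivalently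
  `3·𝔼[Ψ | one odd copy at every coordinate] ≥ 𝔼[Ψ | the copies agree at a, one odd copy elsewhere]`.  It is implied by the comb law
  ORDER-1 (`c_2 ≥ c_3`, `c_1 ≥ c_0` linewise; memo §2(b): `hmSum = Σ_{mixed lines}[(c_1−c_0)+(c_2−c_3)]`), hence census-clean wherever
  ORDER-1 is (`m ≤ 5` exhaustive), and it is TIGHT from `m = 4` (48 of 3 104 864 axis-cases; e.g. `(x_1, x_0(x_1∨x_2∨x_3),
  x_3(x_0∨x_1∨x_2))` along `x_2`); exact-best-response searches at `m = 5, 6, 7` (39 000 / 37 200 / 47 400 multi-slot descents,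
  ≈ 45 % of the exact slot moves accepted) sit on the ratio `1` and never cross it.
* `hmSum_insert` (peeling a free coordinate `e ≠ a`), `hmSum_empty_eq` (the base: `hmSum U a R ∅ = disSum U (insert a R) −
  disSum U^{a←0} R − disSum U^{a←1} R`), `hmSum_nonneg_of_halfMix` (induction on the free set),
  `sqDefect_half_eq` (**at `q ≡ 1/2` the square-weighted defect of `…SahiTwoLevelHalf` is `2^{−3|ι|}·Σ_j ε(j_a)c_U(j)`**, i.e.
  `E_3(U) − ¼E_3(U^{a←1}) − ¼E_3(U^{a←0})` in comb form), **`half_of_halfMix : HalfMix → SahiTwoLevelHalf.Half`** and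
  **`kahnConjecture_of_halfMix`** (via `SahiUniform.kahnConjecture_of_half`).
So the tree's ladder now reads `ORDER-1 ⟹ HALF-MIX ⟹ HALF(½) ⟹ Kahn` and `COMB-C3 ⟹ DIS ⟹ Kahn` with the two MIX rungs being
measure-free counting statements about ONE functional (the full-disagreement sum) and its sections.
Everything below is proved; axioms standard; `HalfMix`, `Half`, `KahnConjecture` remain OPEN (obligations, never facts). [this work]
-/

noncomputable section

open scoped Classical

namespace Summit.CriticalPhenomena.PercolationContinuityZ3.Theorems

open Finset Function
open Literature.Combinatorics.Sahi2008
open Literature.Probability.Percolation (DeterminedBy determinedBy_iff)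
open Literature.Probability.Percolation.DecisionTree (ind ind_of_mem ind_of_not_mem ind_nonneg)
open SahiComb
open SahiTwoLevelHalf (half)

namespace SahiCombMix

variable {ι : Type} [Fintype ι]

/-! ### The HALF letter on a fully mixed background: `HalfMix ⟹ HALF(½)` -/

/-- The HALF letter on a digit: `+1` on the mixed digits `1, 2`, `−1` on the section digits `0, 3`. [this work] -/
def halfLetter (t : ℕ) : ℝ := if t = 1 ∨ t = 2 then 1 else -1

/-- **The lettered mixed/free sum**: `Σ ε(j_a)·c_U(j)` over the profiles mixed on `R`, free on `S ∪ {a}`, `0` elsewhere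
(`ε = halfLetter` at the distinguished axis `a`). [this work] -/
def hmSum (U : Fin 3 → Set (Set ι)) (a : ι) (R S : Finset ι) : ℝ :=
  ∑ j ∈ box (fun _ : ι => 3), if MixFree R (insert a S) j then halfLetter (j a) * combCoeff 3 (fun i => ind (U i)) j else 0

/-- **Conjecture HALF-MIX** (bnk-2 gen 12; INEQ-CLAIMS row HALF-MIX): the full-disagreement sum is SUPER-ADDITIVE under sectioning —
for every triple of increasing events determined by `insert a R` (`a ∉ R`) on every finite cube,
`disSum U^{a←0} R + disSum U^{a←1} R ≤ disSum U (insert a R)`; equivalently `3·𝔼[Ψ | one odd copy at every coordinate] ≥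
𝔼[Ψ | the copies agree at a, one odd copy elsewhere]`.  Implied by the comb law ORDER-1 (memo §2(b)); implies `HALF(½)`
(`half_of_halfMix`) and hence Kahn's Conjecture 5 (`kahnConjecture_of_halfMix`).  Census: `m ≤ 4` exhaustive (tight — equality with a
positive right side — in 48 of 3 104 864 axis-cases at `m = 4`), exact best response `m = 5, 6, 7`: minimum ratio exactly `1`, never below.
OPEN; an obligation of our theories, never a fact. [this work] [status: open] -/
@[conjecture] def HalfMix : Prop :=
  ∀ (ι : Type) [Fintype ι] (U : Fin 3 → Set (Set ι)), (∀ i, IsUpperSet (U i)) →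
    ∀ (R : Finset ι) (a : ι), a ∉ R → (∀ i, DeterminedBy (U i) (↑(insert a R) : Set ι)) →
      disSum (fun i => secAt a false (U i)) R + disSum (fun i => secAt a true (U i)) R ≤ disSum U (insert a R)

/-- `hmSum` may be taken over the box `3[e ↦ 0]` when `e ∉ R ∪ S ∪ {a}`. [this work] -/
theorem hmSum_eq_sum_box_update (U : Fin 3 → Set (Set ι)) {a : ι} {R S : Finset ι} {e : ι} (heR : e ∉ R)
    (heS : e ∉ insert a S) :
    hmSum U a R S = ∑ j ∈ box (update (fun _ : ι => (3 : ℕ)) e 0),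
      if MixFree R (insert a S) j then halfLetter (j a) * combCoeff 3 (fun i => ind (U i)) j else 0 := by
  unfold hmSum
  rw [sum_box_eq_sum_fiber_update (fun _ : ι => (3 : ℕ)) e, Finset.sum_range_succ', Finset.sum_eq_zero, zero_add]
  · refine sum_congr rfl fun j hj => ?_
    rw [update_eq_self_iff.2 (apply_eq_zero_of_mem_box_update hj).symm]
  · intro t _
    refine sum_eq_zero fun j hj => ?_
    have hj0 := apply_eq_zero_of_mem_box_update hj
    rw [if_neg]
    intro h
    exact Nat.succ_ne_zero t ((mixFree_update_iff heR heS hj0 (t + 1)).1 h).1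

/-- **Peeling a free coordinate `e ≠ a` off the lettered sum**:
`hmSum U a R (insert e S) = hmSum U^{e←0} a R S + hmSum U^{e←1} a R S + hmSum U a (insert e R) S`. [this work] -/
theorem hmSum_insert (U : Fin 3 → Set (Set ι)) {a : ι} {R S : Finset ι} {e : ι} (heR : e ∉ R) (heS : e ∉ S)
    (hea : e ≠ a) :
    hmSum U a R (insert e S) = hmSum (fun i => secAt e false (U i)) a R S + hmSum (fun i => secAt e true (U i)) a R S
      + hmSum U a (insert e R) S := by
  have heS' : e ∉ insert a S := fun h => (Finset.mem_insert.1 h).elim hea heS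
  have hins : insert a (insert e S) = insert e (insert a S) := Finset.insert_comm a e S
  set B := box (update (fun _ : ι => (3 : ℕ)) e 0) with hB
  have hB0 : ∀ j ∈ B, j e = 0 := fun j hj => apply_eq_zero_of_mem_box_update hj
  have hεe : ∀ (j : ι → ℕ) (t : ℕ), halfLetter (update j e t a) = halfLetter (j a) := fun j t => by
    rw [update_of_ne (Ne.symm hea)]
  have hd0 : ∑ j ∈ B, (if MixFree R (insert a (insert e S)) (update j e 0) then
        halfLetter (update j e 0 a) * combCoeff 3 (fun i => ind (U i)) (update j e 0) else 0)
      = ∑ j ∈ B, (if MixFree R (insert a S) j then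
        halfLetter (j a) * combCoeff 3 (fun i => ind (secAt e false (U i))) j else 0) := by
    refine sum_congr rfl fun j hj => ?_
    have hj0 := hB0 j hj
    rw [hins, mixFree_insert_update_iff heR heS' hj0, update_eq_self_iff.2 hj0.symm]
    split_ifs
    · rw [combCoeff_ind_eq_secAt_false U e hj0]
    · rfl
  have hd3 : ∑ j ∈ B, (if MixFree R (insert a (insert e S)) (update j e 3) then
        halfLetter (update j e 3 a) * combCoeff 3 (fun i => ind (U i)) (update j e 3) else 0)
      = ∑ j ∈ B, (if MixFree R (insert a S) j then
        halfLetter (j a) * combCoeff 3 (fun i => ind (secAt e true (U i))) j else 0) := by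
    refine sum_congr rfl fun j hj => ?_
    have hj0 := hB0 j hj
    rw [hins, mixFree_insert_update_iff heR heS' hj0, hεe]
    split_ifs
    · rw [combCoeff_ind_update_top_eq_secAt_true U e j, update_eq_self_iff.2 hj0.symm]
    · rfl
  have hd12 : ∀ t : ℕ, (t = 1 ∨ t = 2) →
      ∑ j ∈ B, (if MixFree R (insert a (insert e S)) (update j e t) then
        halfLetter (update j e t a) * combCoeff 3 (fun i => ind (U i)) (update j e t) else 0)
      = ∑ j ∈ B, (if MixFree (insert e R) (insert a S) (update j e t) then
        halfLetter (update j e t a) * combCoeff 3 (fun i => ind (U i)) (update j e t) else 0) := by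
    intro t ht
    refine sum_congr rfl fun j hj => ?_
    have hj0 := hB0 j hj
    have hiff : MixFree R (insert a (insert e S)) (update j e t) ↔ MixFree (insert e R) (insert a S) (update j e t) := by
      rw [hins, mixFree_insert_update_iff heR heS' hj0, mixFree_insert_left_update_iff heR heS' hj0]
      exact ⟨fun h => ⟨ht, h⟩, fun h => h.2⟩
    simp only [hiff]
  have hz : ∀ t : ℕ, ¬(t = 1 ∨ t = 2) →
      ∑ j ∈ B, (if MixFree (insert e R) (insert a S) (update j e t) then
        halfLetter (update j e t a) * combCoeff 3 (fun i => ind (U i)) (update j e t) else 0) = 0 := by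
    intro t ht
    refine sum_eq_zero fun j hj => ?_
    rw [if_neg]
    intro h
    exact ht ((mixFree_insert_left_update_iff heR heS' (hB0 j hj) t).1 h).1
  have hL : hmSum U a R (insert e S) =
      ∑ j ∈ B, (if MixFree R (insert a S) j then
        halfLetter (j a) * combCoeff 3 (fun i => ind (secAt e false (U i))) j else 0)
      + ∑ j ∈ B, (if MixFree (insert e R) (insert a S) (update j e 1) then
        halfLetter (update j e 1 a) * combCoeff 3 (fun i => ind (U i)) (update j e 1) else 0)
      + ∑ j ∈ B, (if MixFree (insert e R) (insert a S) (update j e 2) then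
        halfLetter (update j e 2 a) * combCoeff 3 (fun i => ind (U i)) (update j e 2) else 0)
      + ∑ j ∈ B, (if MixFree R (insert a S) j then
        halfLetter (j a) * combCoeff 3 (fun i => ind (secAt e true (U i))) j else 0) := by
    unfold hmSum
    rw [sum_box_eq_sum_fiber_update (fun _ : ι => (3 : ℕ)) e]
    simp only [Finset.sum_range_succ, Finset.sum_range_zero, zero_add]
    rw [← hB, hd0, hd3, hd12 1 (Or.inl rfl), hd12 2 (Or.inr rfl)]
  have hM : hmSum U a (insert e R) S =
      ∑ j ∈ B, (if MixFree (insert e R) (insert a S) (update j e 1) then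
        halfLetter (update j e 1 a) * combCoeff 3 (fun i => ind (U i)) (update j e 1) else 0)
      + ∑ j ∈ B, (if MixFree (insert e R) (insert a S) (update j e 2) then
        halfLetter (update j e 2 a) * combCoeff 3 (fun i => ind (U i)) (update j e 2) else 0) := by
    unfold hmSum
    rw [sum_box_eq_sum_fiber_update (fun _ : ι => (3 : ℕ)) e]
    simp only [Finset.sum_range_succ, Finset.sum_range_zero, zero_add]
    rw [← hB, hz 0 (by omega), hz 3 (by omega), zero_add, add_zero]
  rw [hL, hM, hmSum_eq_sum_box_update _ heR heS', hmSum_eq_sum_box_update _ heR heS', ← hB]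
  ring

/-- **The base of the lettered induction**: with no free coordinate, the lettered sum is
`disSum U (insert a R) − disSum U^{a←0} R − disSum U^{a←1} R` (split the digit at `a`). [this work] -/
theorem hmSum_empty_eq (U : Fin 3 → Set (Set ι)) {a : ι} {R : Finset ι} (haR : a ∉ R) :
    hmSum U a R ∅ = disSum U (insert a R) - disSum (fun i => secAt a false (U i)) R
      - disSum (fun i => secAt a true (U i)) R := by
  have ha0 : a ∉ (∅ : Finset ι) := Finset.notMem_empty a
  set B := box (update (fun _ : ι => (3 : ℕ)) a 0) with hB
  have hB0 : ∀ j ∈ B, j a = 0 := fun j hj => apply_eq_zero_of_mem_box_update hj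
  -- digit t at a: condition and letter
  have hdig : ∀ t : ℕ, ∑ j ∈ B, (if MixFree R (insert a ∅) (update j a t) then
        halfLetter (update j a t a) * combCoeff 3 (fun i => ind (U i)) (update j a t) else 0)
      = halfLetter t * ∑ j ∈ B, (if MixFree R ∅ j then combCoeff 3 (fun i => ind (U i)) (update j a t) else 0) := by
    intro t
    rw [mul_sum]
    refine sum_congr rfl fun j hj => ?_
    rw [mixFree_insert_update_iff haR ha0 (hB0 j hj), update_self]
    split_ifs
    · rfl
    · rw [mul_zero]
  have hd0 : ∑ j ∈ B, (if MixFree R ∅ j then combCoeff 3 (fun i => ind (U i)) (update j a 0) else 0)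
      = disSum (fun i => secAt a false (U i)) R := by
    unfold disSum
    rw [mfSum_eq_sum_box_update _ haR ha0, ← hB]
    refine sum_congr rfl fun j hj => ?_
    have hj0 := hB0 j hj
    rw [update_eq_self_iff.2 hj0.symm]
    split_ifs
    · exact combCoeff_ind_eq_secAt_false U a hj0
    · rfl
  have hd3 : ∑ j ∈ B, (if MixFree R ∅ j then combCoeff 3 (fun i => ind (U i)) (update j a 3) else 0)
      = disSum (fun i => secAt a true (U i)) R := by
    unfold disSum
    rw [mfSum_eq_sum_box_update _ haR ha0, ← hB]
    refine sum_congr rfl fun j hj => ?_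
    have hj0 := hB0 j hj
    split_ifs
    · rw [combCoeff_ind_update_top_eq_secAt_true U a j, update_eq_self_iff.2 hj0.symm]
    · rfl
  have hd12 : ∀ t : ℕ, (t = 1 ∨ t = 2) →
      ∑ j ∈ B, (if MixFree R ∅ j then combCoeff 3 (fun i => ind (U i)) (update j a t) else 0)
      = ∑ j ∈ B, (if MixFree (insert a R) ∅ (update j a t) then combCoeff 3 (fun i => ind (U i)) (update j a t) else 0) := by
    intro t ht
    refine sum_congr rfl fun j hj => ?_
    have hiff : MixFree R ∅ j ↔ MixFree (insert a R) ∅ (update j a t) := by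
      rw [mixFree_insert_left_update_iff haR ha0 (hB0 j hj)]
      exact ⟨fun h => ⟨ht, h⟩, fun h => h.2⟩
    simp only [hiff]
  have hz : ∀ t : ℕ, ¬(t = 1 ∨ t = 2) →
      ∑ j ∈ B, (if MixFree (insert a R) ∅ (update j a t) then combCoeff 3 (fun i => ind (U i)) (update j a t) else 0) = 0 := by
    intro t ht
    refine sum_eq_zero fun j hj => ?_
    rw [if_neg]
    intro h
    exact ht ((mixFree_insert_left_update_iff haR ha0 (hB0 j hj) t).1 h).1
  have hD : disSum U (insert a R) =
      ∑ j ∈ B, (if MixFree (insert a R) ∅ (update j a 1) then combCoeff 3 (fun i => ind (U i)) (update j a 1) else 0)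
      + ∑ j ∈ B, (if MixFree (insert a R) ∅ (update j a 2) then combCoeff 3 (fun i => ind (U i)) (update j a 2) else 0) := by
    unfold disSum mfSum
    rw [sum_box_eq_sum_fiber_update (fun _ : ι => (3 : ℕ)) a]
    simp only [Finset.sum_range_succ, Finset.sum_range_zero, zero_add]
    rw [← hB, hz 0 (by omega), hz 3 (by omega), zero_add, add_zero]
  have hε0 : halfLetter 0 = -1 := by simp [halfLetter]
  have hε1 : halfLetter 1 = 1 := by simp [halfLetter]
  have hε2 : halfLetter 2 = 1 := by simp [halfLetter]
  have hε3 : halfLetter 3 = -1 := by simp [halfLetter]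
  unfold hmSum
  rw [sum_box_eq_sum_fiber_update (fun _ : ι => (3 : ℕ)) a]
  simp only [Finset.sum_range_succ, Finset.sum_range_zero, zero_add]
  rw [← hB, hdig 0, hdig 1, hdig 2, hdig 3, hd0, hd3, hd12 1 (Or.inl rfl), hd12 2 (Or.inr rfl), hD, hε0, hε1, hε2, hε3]
  ring

/-- **`HalfMix ⟹ 0 ≤ hmSum U a R S`** for every triple of increasing events determined by `insert a (R ∪ S)`: induction on `S` by
peeling, the base being `HalfMix` itself (`hmSum_empty_eq`). [this work] -/
theorem hmSum_nonneg_of_halfMix (hH : HalfMix) (a : ι) (S : Finset ι) :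
    ∀ (R : Finset ι), a ∉ R → a ∉ S → Disjoint R S → ∀ (U : Fin 3 → Set (Set ι)), (∀ i, IsUpperSet (U i)) →
      (∀ i, DeterminedBy (U i) (↑(insert a (R ∪ S)) : Set ι)) → 0 ≤ hmSum U a R S := by
  induction S using Finset.induction_on with
  | empty =>
    intro R haR _ _ U hU hUd
    rw [hmSum_empty_eq U haR]
    have h := hH ι U hU R a haR (fun i => by simpa using hUd i)
    linarith
  | insert e S heS ih =>
    intro R haR haS hRS U hU hUd
    have hea : e ≠ a := fun h => haS (h ▸ Finset.mem_insert_self e S)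
    have haS' : a ∉ S := fun h => haS (Finset.mem_insert_of_mem h)
    have heR : e ∉ R := fun h => Finset.disjoint_left.1 hRS h (Finset.mem_insert_self e S)
    have hRS' : Disjoint R S := Finset.disjoint_of_subset_right (Finset.subset_insert e S) hRS
    rw [hmSum_insert U heR heS hea]
    have hkey : (insert a (R ∪ insert e S)).erase e = insert a (R ∪ S) := by
      ext x
      simp only [Finset.mem_erase, Finset.mem_insert, Finset.mem_union]
      constructor
      · rintro ⟨hxe, hx | hx | hx | hx⟩
        · exact Or.inl hx
        · exact Or.inr (Or.inl hx)
        · exact absurd hx hxe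
        · exact Or.inr (Or.inr hx)
      · rintro (hx | hx | hx)
        · exact ⟨fun h => hea (h ▸ hx), Or.inl hx⟩
        · exact ⟨fun h => heR (h ▸ hx), Or.inr (Or.inl hx)⟩
        · exact ⟨fun h => heS (h ▸ hx), Or.inr (Or.inr (Or.inr hx))⟩
    have hsec : ∀ (b : Bool) (i : Fin 3), DeterminedBy (secAt e b (U i)) (↑(insert a (R ∪ S)) : Set ι) := by
      intro b i
      have h := determinedBy_secAt e b (hUd i)
      rwa [hkey] at h
    refine add_nonneg (add_nonneg ?_ ?_) ?_
    · exact ih R haR haS' hRS' _ (fun i => isUpperSet_secAt e false (hU i)) (hsec false)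
    · exact ih R haR haS' hRS' _ (fun i => isUpperSet_secAt e true (hU i)) (hsec true)
    · refine ih (insert e R) (fun h => (Finset.mem_insert.1 h).elim (fun h' => hea h'.symm) haR) haS' ?_ U hU (fun i => ?_)
      · rw [Finset.disjoint_insert_left]; exact ⟨heS, hRS'⟩
      · have : insert a (insert e R ∪ S) = insert a (R ∪ insert e S) := by
          ext x; simp only [Finset.mem_union, Finset.mem_insert]; tauto
        rw [this]; exact hUd i

/-- The full lettered sum `Σ_j ε(j_a)·c_U(j)` is `hmSum` with everything free. [this work] -/
theorem sum_halfLetter_mul_combCoeff_eq_hmSum (U : Fin 3 → Set (Set ι)) (a : ι) :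
    ∑ j ∈ box (fun _ : ι => 3), halfLetter (j a) * combCoeff 3 (fun i => ind (U i)) j =
      hmSum U a ∅ (Finset.univ.erase a) := by
  unfold hmSum
  refine sum_congr rfl fun j _ => ?_
  rw [if_pos]
  refine ⟨fun e he => absurd he (Finset.notMem_empty e), fun e _ he => absurd ?_ he⟩
  rw [Finset.insert_erase (Finset.mem_univ a)]
  exact Finset.mem_univ e

/-- **`HalfMix ⟹` the lettered comb sum along every axis is `≥ 0`.** [this work] -/
theorem sum_halfLetter_mul_combCoeff_nonneg_of_halfMix (hH : HalfMix) (U : Fin 3 → Set (Set ι))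
    (hU : ∀ i, IsUpperSet (U i)) (a : ι) :
    0 ≤ ∑ j ∈ box (fun _ : ι => 3), halfLetter (j a) * combCoeff 3 (fun i => ind (U i)) j := by
  rw [sum_halfLetter_mul_combCoeff_eq_hmSum]
  refine hmSum_nonneg_of_halfMix hH a (Finset.univ.erase a) ∅ (Finset.notMem_empty a)
    (Finset.notMem_erase a _) (Finset.disjoint_empty_left _) U hU fun i => ?_
  rw [Finset.empty_union, Finset.insert_erase (Finset.mem_univ a), Finset.coe_univ]
  exact (determinedBy_iff _ _).2 fun ω ω' h => by
    have : ω = ω' := by simpa using h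
    rw [this]

/-! ### The square-weighted defect at `q ≡ 1/2` is the lettered comb sum -/

/-- `Σ_j c_{U^{a←b}}(j) = 8·Σ_{j, j_a = 0} c(j[a ↦ 3b])`: the total comb sum of a section, which ignores `a`. [this work] -/
theorem sum_combCoeff_secAt_eq (U : Fin 3 → Set (Set ι)) (a : ι) (b : Bool) :
    ∑ j ∈ box (fun _ : ι => 3), combCoeff 3 (fun i => ind (secAt a b (U i))) j =
      8 * ∑ j ∈ box (update (fun _ : ι => (3 : ℕ)) a 0),
        combCoeff 3 (fun i => ind (U i)) (update j a (cond b 3 0)) := by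
  rw [sum_box_eq_sum_fiber_update (fun _ : ι => (3 : ℕ)) a]
  have hig : ∀ (t : ℕ) (j : ι → ℕ), combCoeff 3 (fun i => ind (secAt a b (U i))) (update j a t) =
      ((3 : ℕ).choose t : ℝ) * combCoeff 3 (fun i => ind (secAt a b (U i))) (update j a 0) :=
    fun t j => combCoeff_update_of_ignores (fun i ω => ind_secAt_insert a b (U i) ω) j t
  have hsec : ∀ j ∈ box (update (fun _ : ι => (3 : ℕ)) a 0),
      combCoeff 3 (fun i => ind (secAt a b (U i))) (update j a 0) = combCoeff 3 (fun i => ind (U i)) (update j a (cond b 3 0)) := by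
    intro j hj
    have hj0 := apply_eq_zero_of_mem_box_update hj
    cases b
    · simp only [cond_false]
      rw [update_eq_self_iff.2 hj0.symm]
      exact (combCoeff_ind_eq_secAt_false U a hj0).symm
    · simp only [cond_true]
      exact (combCoeff_ind_update_top_eq_secAt_true U a j).symm
  have hsum : ∀ t : ℕ, ∑ j ∈ box (update (fun _ : ι => (3 : ℕ)) a 0),
      combCoeff 3 (fun i => ind (secAt a b (U i))) (update j a t) =
      ((3 : ℕ).choose t : ℝ) * ∑ j ∈ box (update (fun _ : ι => (3 : ℕ)) a 0),
        combCoeff 3 (fun i => ind (U i)) (update j a (cond b 3 0)) := by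
    intro t
    rw [mul_sum]
    refine sum_congr rfl fun j hj => ?_
    rw [hig t j, hsec j hj]
  simp only [Finset.sum_range_succ, Finset.sum_range_zero, zero_add]
  rw [hsum 0, hsum 1, hsum 2, hsum 3, show (3 : ℕ).choose 0 = 1 by decide, show (3 : ℕ).choose 1 = 3 by decide,
    show (3 : ℕ).choose 2 = 3 by decide, show (3 : ℕ).choose 3 = 1 by decide]
  push_cast
  ring

/-- **At `q ≡ 1/2` the square-weighted defect is the lettered comb sum**:
`sqDefect (1/2) a U = 2^{−3|ι|}·Σ_j ε(j_a)·c_U(j)`, `ε = (−1,1,1,−1)` (`E_3(U) − ¼E_3(U^{a←1}) − ¼E_3(U^{a←0})`). [this work] -/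
theorem sqDefect_half_eq (U : Fin 3 → Set (Set ι)) (a : ι) :
    SahiTwoLevelHalf.sqDefect (fun _ : ι => half) a U =
      ((1 : ℝ) / 2) ^ (3 * Fintype.card ι) * ∑ j ∈ box (fun _ : ι => 3), halfLetter (j a) * combCoeff 3 (fun i => ind (U i)) j := by
  unfold SahiTwoLevelHalf.sqDefect
  rw [SahiGoodAxis.cubicE3_self_eq, FibreCubic.cubicE3_one_eq_secAt, SahiLogDerivEnd.cubicE3_zero_eq_secAt,
    sahiE_half_eq_sum_combCoeff, sahiE_half_eq_sum_combCoeff, sahiE_half_eq_sum_combCoeff,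
    sum_combCoeff_secAt_eq U a true, sum_combCoeff_secAt_eq U a false]
  simp only [cond_true, cond_false]
  have hq : (((fun _ : ι => half) a : unitInterval) : ℝ) = 1 / 2 := rfl
  rw [hq]
  -- the full sums, split at `a`
  rw [sum_box_eq_sum_fiber_update (fun _ : ι => (3 : ℕ)) a, sum_box_eq_sum_fiber_update (fun _ : ι => (3 : ℕ)) a]
  simp only [update_self, Finset.sum_range_succ, Finset.sum_range_zero, zero_add]
  have hε0 : halfLetter 0 = -1 := by simp [halfLetter]
  have hε1 : halfLetter 1 = 1 := by simp [halfLetter]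
  have hε2 : halfLetter 2 = 1 := by simp [halfLetter]
  have hε3 : halfLetter 3 = -1 := by simp [halfLetter]
  rw [hε0, hε1, hε2, hε3]
  simp only [neg_one_mul, one_mul, Finset.sum_neg_distrib]
  ring

/-- **`HalfMix ⟹ HALF(½)`** (`SahiTwoLevelHalf.Half`). [this work] -/
theorem half_of_halfMix (hH : HalfMix) : SahiTwoLevelHalf.Half := by
  intro r U hU a
  rw [sqDefect_half_eq]
  exact mul_nonneg (pow_nonneg (by norm_num) _) (sum_halfLetter_mul_combCoeff_nonneg_of_halfMix hH U hU a)

end SahiCombMix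

open SahiCombMix

/-- **HALF-MIX ⟹ KAHN'S CONJECTURE 5** (through `HALF(½)`, `SahiUniform.kahnConjecture_of_half`). [this work] -/
theorem kahnConjecture_of_halfMix (hH : HalfMix) : KahnConjecture :=
  SahiUniform.kahnConjecture_of_half (half_of_halfMix hH)

end Summit.CriticalPhenomena.PercolationContinuityZ3.Theorems
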